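import Literature.Barriers.Schanuel.LinearSubgroupMethodLimit
import Mathlib.LinearAlgebra.FiniteDimensional.Lemmas
import HarnessLib

/-!
# Roy 1995, Theorem 3.4 — proof (`roy1995_thm_3_4_holds`)

This file DISCHARGES the named fact `Literature.Barriers.Schanuel.roy1995_thm_3_4` of
`Literature/Barriers/Schanuel/LinearSubgroupMethodLimit.lean` (the declaration behind the barrier
`LinearSubgroupMethodLimit`): for `d, l ≥ 1`, `λ₁, λ₂, λ₃ ∈ ℂ` linearly independent over `ℚ̄`, and
a `d × l` matrix `M` with entries in `⟨λ₁, λ₂, λ₃⟩_ℚ`, `ℚ`-independent rows and `ℚ`-independent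
columns, `d + l ≤ 4 · rank M` [Roy1995, Theorem 3.4 p. 66]. Consequently the no-go
`not_lstHypothesis_of_roy1995_thm_3_4` holds unconditionally (`not_lstHypothesis`), and the
catalogue declaration `LinearSubgroupMethodLimit` (definitionally `roy1995_thm_3_4`) is discharged
as `LinearSubgroupMethodLimit_holds` (synonym: `linearSubgroupMethodLimit_holds`).

## The printed proof [Roy1995, p. 66] and its rendering

Roy: let `L₀ = ⟨λ₁, λ₂, λ₃⟩_ℚ`, `E ⊆ L₀^l` the `ℚ`-span of the rows; pick `u₁ ∈ E ∖ 0` whose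
smallest `ℚ`-defined subspace `U ∋ u₁` of `K^l` has minimal dimension; with
`d₁ = dim_ℚ (E ∩ U)`, `l₁ = dim U`, `r₁ = dim_K ⟨E ∩ U⟩_K` one has `d₁ + l₁ ≤ 4 r₁`
(`d₁, l₁ ≤ 3`; if `r₁ = 1` every element of `E ∩ U` is `t u₁` with `t L₁ ⊆ L₀`, and the space of
such `t` has dimension `1 / ≤ 2 / ≤ 3` for `l₁ = 3 / 2 / 1` because the `λ`'s are linearly
independent over `ℚ̄`); then block-triangularise `PMQ = (M₁ 0; M₃ M₂)` and induct on the rank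
(`r₂ ≤ r − r₁`).

We run the same argument on COEFFICIENT TRIPLES: a vector of `L₀^l` is `Φ A = (Σ_k A k j • λ_k)_j`
for a unique `A : Fin 3 → (Fin l → F)` (`Roy1995.realize_injective`), so `E` becomes an
`F`-subspace of `Fin 3 → Fin l → F`; "columns independent" becomes the column condition
`∀ c, (∀ A ∈ E, ∀ k, A k ⬝ᵥ c = 0) → c = 0`; the smallest `ℚ`-defined subspace containing `Φ A`
is spanned by the three rows `A k`, so `l₁ = dim ⟨rows of A₁⟩` with `A₁` of minimal row-span
dimension. Instead of the matrices `P, Q` we use the quotient map `g : F^l → F^{l − l₁}` with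
kernel `⟨rows of A₁⟩` (`exists_surjective_ker_eq`): `M₂` is `g(E)` (`colCond_map` = "columns of
`M₂` independent", rank–nullity over `F` = "`d = d₁ + d₂`"), and `r₂ + r₁ ≤ r` is rank–nullity
over `K` for the base change of `g` (`rank_split`). The claim `d₁ + l₁ ≤ 4 r₁` is
`Roy1995.claim`; its arithmetic input is isolated as the MULTIPLIER PROPERTY `s L₀ ⊆ L₀ ⇒ s ∈ F`
(`not_three_multipliers`, `card_le_one_of_mem_bot`), which for `ℂ/ℚ` is the already-proved
`exists_eq_algebraMap_of_mul_mem_span`. Everything is done for an arbitrary field extension `K/F`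
(`Roy1995.add_le_four_mul_rank`, the maps `Φ l` kept abstract through a hypothesis `hΦ` so that
the file declares no auxiliary definitions) and specialised to `ℂ/ℚ` at the end. The hypotheses
`0 < d`, `0 < l` of the named fact are not needed. Not here: anything about Theorem 1.2 itself
(`waldschmidt1981_linearSubgroup_matrix` stays a named fact).

## References

* [Roy1995] D. Roy, *Points whose coordinates are logarithms of algebraic numbers on algebraic
  varieties*, Acta Math. 175 (1995) 49–73, §3.2, Theorem 3.4 and its proof, p. 66.
-/

noncomputable section

open Module Submodule

namespace Literature.Barriers.Schanuel

namespace Roy1995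

variable {F K : Type*} [Field F] [Field K] [Algebra F K]

/-! ### Coefficient triples and their realisation

Throughout, `Φ : (l : ℕ) → (Fin 3 → Fin l → F) →ₗ[F] (Fin l → K)` is ANY family of linear maps
with `Φ l A j = Σ_k A k j • lam k` (hypothesis `hΦ`); such a family is written down in
`add_le_four_mul_rank`. (Keeping `Φ` abstract keeps this file free of auxiliary definitions.) -/

/-- The entries of a realised row lie in `L₀ = ⟨λ₁, λ₂, λ₃⟩_F`.
[cite: Roy1995, §3.2 proof of Theorem 3.4] -/
theorem realize_apply_mem {lam : Fin 3 → K} (Φ : (l : ℕ) → (Fin 3 → Fin l → F) →ₗ[F] (Fin l → K))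
    (hΦ : ∀ l A j, Φ l A j = ∑ k, A k j • lam k) (l : ℕ) (A : Fin 3 → Fin l → F) (j : Fin l) :
    Φ l A j ∈ span F (Set.range lam) := by
  rw [hΦ]
  refine Submodule.sum_mem _ fun k _ => ?_
  exact Submodule.smul_mem _ _ (subset_span (Set.mem_range_self k))

/-- If `λ₁, λ₂, λ₃` are `F`-linearly independent, a row determines its coefficient triple.
[cite: Roy1995, §3.2 proof of Theorem 3.4] -/
theorem realize_injective {lam : Fin 3 → K} (hlam : LinearIndependent F lam)
    (Φ : (l : ℕ) → (Fin 3 → Fin l → F) →ₗ[F] (Fin l → K))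
    (hΦ : ∀ l A j, Φ l A j = ∑ k, A k j • lam k) (l : ℕ) : Function.Injective (Φ l) := by
  intro A B hAB
  funext k j
  have hj : ∑ k, (A k j - B k j) • lam k = 0 := by
    have h := congr_fun hAB j
    rw [hΦ, hΦ] at h
    simp only [sub_smul, Finset.sum_sub_distrib, h, sub_self]
  exact sub_eq_zero.mp (Fintype.linearIndependent_iff.mp hlam _ hj k)

/-- Transpose identity: `g v ⬝ᵥ c' = v ⬝ᵥ (gᵀ c')`. [folklore] -/
theorem dotProduct_pullback {l l' : ℕ} (g : (Fin l → F) →ₗ[F] (Fin l' → F)) (c' : Fin l' → F)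
    (v : Fin l → F) :
    g v ⬝ᵥ c' = v ⬝ᵥ fun j => g (fun j' => if j = j' then 1 else 0) ⬝ᵥ c' := by
  rw [LinearMap.pi_apply_eq_sum_univ g v]
  simp only [dotProduct, Finset.sum_apply, Pi.smul_apply, smul_eq_mul, Finset.sum_mul,
    Finset.mul_sum]
  rw [Finset.sum_comm]
  refine Finset.sum_congr rfl fun j _ => Finset.sum_congr rfl fun i _ => ?_
  ring

/-- A subspace `S ≤ F^l` is the kernel of a surjection `F^l → F^{l - dim S}`. [folklore] -/
theorem exists_surjective_ker_eq {l : ℕ} (S : Submodule F (Fin l → F)) :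
    ∃ g : (Fin l → F) →ₗ[F] (Fin (l - finrank F S) → F),
      Function.Surjective g ∧ LinearMap.ker g = S := by
  have h : finrank F ((Fin l → F) ⧸ S) = finrank F (Fin (l - finrank F S) → F) := by
    have := S.finrank_quotient_add_finrank
    rw [Module.finrank_fin_fun] at this
    rw [Module.finrank_fin_fun]
    omega
  let e := LinearEquiv.ofFinrankEq _ _ h
  refine ⟨e.toLinearMap ∘ₗ S.mkQ, e.surjective.comp (Submodule.mkQ_surjective S), ?_⟩
  rw [LinearEquiv.ker_comp, Submodule.ker_mkQ]

/-- Rank–nullity for the restriction of a linear map to a subspace: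
`dim E = dim f(E) + dim (E ∩ ker f)`. [folklore] -/
theorem finrank_eq_finrank_map_add {R V W : Type*} [Field R] [AddCommGroup V] [Module R V]
    [AddCommGroup W] [Module R W] [FiniteDimensional R V] (f : V →ₗ[R] W) (E : Submodule R V) :
    finrank R E = finrank R (E.map f) + finrank R (E ⊓ LinearMap.ker f : Submodule R V) := by
  have h := LinearMap.finrank_range_add_finrank_ker (f.domRestrict E)
  rw [LinearMap.range_domRestrict, LinearMap.ker_domRestrict] at h
  rw [← h]
  congr 1
  have : (LinearMap.ker f).comap E.subtype = (E ⊓ LinearMap.ker f).comap E.subtype := by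
    rw [Submodule.comap_inf, Submodule.comap_subtype_self, top_inf_eq]
  rw [this]
  exact (Submodule.comapSubtypeEquivOfLe inf_le_left).finrank_eq

/-! ### Splitting off a quotient

Roy's hypothesis "the columns of `M` are `ℚ`-linearly independent" reads, on a space `E` of
coefficient triples: no non-zero `c ∈ F^l` is orthogonal to all rows of all elements of `E`
(`∀ c, (∀ A ∈ E, ∀ k, A k ⬝ᵥ c = 0) → c = 0`). -/

/-- The column condition passes to the image under a surjection applied row-wise ("the columns
of `M₂` are independent"). [cite: Roy1995, §3.2 proof of Theorem 3.4] -/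
theorem colCond_map {l l' : ℕ} {g : (Fin l → F) →ₗ[F] (Fin l' → F)} (hg : Function.Surjective g)
    {E : Submodule F (Fin 3 → Fin l → F)}
    (hE : ∀ c : Fin l → F, (∀ A ∈ E, ∀ k, A k ⬝ᵥ c = 0) → c = 0) :
    ∀ c' : Fin l' → F, (∀ B ∈ E.map (g.compLeft (Fin 3)), ∀ k, B k ⬝ᵥ c' = 0) → c' = 0 := by
  classical
  intro c' hc'
  set c : Fin l → F := fun j => g (fun j' => if j = j' then 1 else 0) ⬝ᵥ c' with hc
  have hc0 : c = 0 := hE c fun A hA k => by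
    rw [hc, ← dotProduct_pullback]
    exact hc' (g ∘ A) ⟨A, hA, rfl⟩ k
  funext i
  obtain ⟨v, hv⟩ := hg (Pi.single i 1)
  have h := dotProduct_pullback g c' v
  rw [hv, ← hc, hc0, dotProduct_zero, single_one_dotProduct] at h
  exact h

/-- Rank splitting along `g`: `r₂ + r₁ ≤ r`, where `r` is the `K`-dimension of the span of the
realised rows of `E`, `r₂` that of `g(E)` and `r₁` that of `E ∩ ker g` (rank–nullity over `K` for
the base change `f` of `g`, which satisfies `f (Φ A) = Φ (g ∘ A)`).
[cite: Roy1995, §3.2 proof of Theorem 3.4 ("the rank r₂ of M₂ is ≤ r − r₁")] -/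
theorem rank_split {lam : Fin 3 → K} (Φ : (l : ℕ) → (Fin 3 → Fin l → F) →ₗ[F] (Fin l → K))
    (hΦ : ∀ l A j, Φ l A j = ∑ k, A k j • lam k) {l l' : ℕ}
    (g : (Fin l → F) →ₗ[F] (Fin l' → F)) (E : Submodule F (Fin 3 → Fin l → F)) :
    finrank K (span K ((E.map (g.compLeft (Fin 3))).map (Φ l') : Set (Fin l' → K))) +
        finrank K (span K ((E ⊓ LinearMap.ker (g.compLeft (Fin 3))).map (Φ l) :
          Set (Fin l → K))) ≤
      finrank K (span K (E.map (Φ l) : Set (Fin l → K))) := by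
  classical
  set p := span K (E.map (Φ l) : Set (Fin l → K)) with hp
  -- the base change of `g` to `K`
  set f : (Fin l → K) →ₗ[K] (Fin l' → K) := Matrix.mulVecLin
    (Matrix.of fun i j => algebraMap F K (g (fun j' => if j = j' then 1 else 0) i)) with hf
  have hfΦ : ∀ A : Fin 3 → Fin l → F, f (Φ l A) = Φ l' (g ∘ A) := by
    intro A
    funext i
    simp only [hf, Matrix.mulVecLin_apply, Matrix.mulVec, dotProduct, Matrix.of_apply]
    simp only [hΦ, Function.comp_apply, ← Algebra.smul_def, Finset.smul_sum, smul_smul]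
    conv_rhs =>
      arg 2
      ext k
      rw [LinearMap.pi_apply_eq_sum_univ g (A k), Finset.sum_apply, Finset.sum_smul]
    refine Finset.sum_comm.trans
      (Finset.sum_congr rfl fun k _ => Finset.sum_congr rfl fun j _ => ?_)
    rw [Pi.smul_apply, smul_eq_mul, mul_comm]
  have h1 : span K ((E.map (g.compLeft (Fin 3))).map (Φ l') : Set (Fin l' → K)) = p.map f := by
    rw [hp, ← Submodule.span_image]
    congr 1
    ext y
    simp only [SetLike.mem_coe, Submodule.mem_map, Set.mem_image]
    constructor
    · rintro ⟨B, ⟨A, hA, rfl⟩, rfl⟩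
      exact ⟨Φ l A, ⟨A, hA, rfl⟩, hfΦ A⟩
    · rintro ⟨x, ⟨A, hA, rfl⟩, rfl⟩
      exact ⟨g ∘ A, ⟨A, hA, rfl⟩, (hfΦ A).symm⟩
  have h2 := finrank_eq_finrank_map_add f p
  have h3 : span K ((E ⊓ LinearMap.ker (g.compLeft (Fin 3))).map (Φ l) :
      Set (Fin l → K)) ≤ p ⊓ LinearMap.ker f := by
    rw [span_le]
    rintro _ ⟨A, hA, rfl⟩
    refine ⟨subset_span ⟨A, hA.1, rfl⟩, ?_⟩
    have hA2 : g ∘ A = 0 := by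
      funext k
      simpa using congr_fun (LinearMap.mem_ker.mp hA.2) k
    rw [SetLike.mem_coe, LinearMap.mem_ker, hfΦ, hA2, map_zero]
  have h4 := Submodule.finrank_mono h3
  rw [h1]
  omega

/-! ### The multiplier bounds -/

/-- Row rank equals column rank, for a triple of vectors of `F^l` viewed as a `3 × l` matrix.
[folklore] -/
theorem finrank_span_cols_eq {l : ℕ} (A : Fin 3 → Fin l → F) :
    finrank F (span F (Set.range fun j k => A k j)) = finrank F (span F (Set.range A)) := by
  have h1 := (Matrix.of A).rank_eq_finrank_span_cols
  have h2 := (Matrix.of A).rank_eq_finrank_span_row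
  exact h1.symm.trans h2

/-- A linearly independent family inside a subspace `T` has at most `dim T` members. [folklore] -/
theorem card_le_finrank_of_mem {ι : Type*} [Fintype ι] {t : ι → K} (ht : LinearIndependent F t)
    (T : Submodule F K) [Module.Finite F T] (hmem : ∀ i, t i ∈ T) :
    Fintype.card ι ≤ finrank F T := by
  have h : LinearIndependent F (fun i => (⟨t i, hmem i⟩ : T)) :=
    LinearIndependent.of_comp T.subtype (by simpa [Function.comp_def] using ht)
  exact h.fintype_card_le_finrank

/-- **Two-multiplier lemma** (Roy: "the dimension over `ℚ` of the set of all `t ∈ K` such that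
`tL₁ ⊆ L₀` is … `≤ 2` if `l₁ = 2`"): if `w₀, w₁ ∈ K` are `F`-linearly independent, no three
`F`-linearly independent `t`'s satisfy `tᵢ w₀, tᵢ w₁ ∈ L₀ = ⟨λ₁, λ₂, λ₃⟩_F` — given the
multiplier property of `L₀` (`s L₀ ⊆ L₀ ⇒ s ∈ F`). [cite: Roy1995, §3.2 proof of Theorem 3.4] -/
theorem not_three_multipliers {lam : Fin 3 → K} (hlam : LinearIndependent F lam)
    (hmul : ∀ s : K, (∀ x ∈ span F (Set.range lam), s * x ∈ span F (Set.range lam)) →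
      ∃ c : F, s = algebraMap F K c)
    {w : Fin 2 → K} (hw : LinearIndependent F w) {t : Fin 3 → K} (ht : LinearIndependent F t)
    (h0 : ∀ i, t i * w 0 ∈ span F (Set.range lam)) (h1 : ∀ i, t i * w 1 ∈ span F (Set.range lam)) :
    False := by
  haveI : Module.Finite F (span F (Set.range lam)) :=
    Module.Finite.span_of_finite F (Set.finite_range lam)
  have hL₀ : finrank F (span F (Set.range lam)) = 3 := by
    rw [finrank_span_eq_card hlam, Fintype.card_fin]
  have hw0 : w 0 ≠ 0 := hw.ne_zero 0
  -- `T₃ = ⟨t₀, t₁, t₂⟩_F` maps isomorphically onto `L₀` under `x ↦ x * w i`, `i = 0, 1`.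
  have hmap : ∀ i : Fin 2, (∀ m, t m * w i ∈ span F (Set.range lam)) →
      (span F (Set.range t)).map (LinearMap.mulRight F (w i)) = span F (Set.range lam) := by
    intro i hi
    have hwi : w i ≠ 0 := hw.ne_zero i
    have hle :
        (span F (Set.range t)).map (LinearMap.mulRight F (w i)) ≤ span F (Set.range lam) := by
      rw [Submodule.map_le_iff_le_comap, span_le]
      rintro _ ⟨m, rfl⟩
      simpa using hi m
    refine Submodule.eq_of_le_of_finrank_eq hle ?_
    rw [hL₀, ← (Submodule.equivMapOfInjective _ (mul_left_injective₀ hwi) _).finrank_eq,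
      finrank_span_eq_card ht, Fintype.card_fin]
  -- hence `(w 1 / w 0) L₀ ⊆ L₀`
  obtain ⟨c, hc⟩ := hmul (w 1 * (w 0)⁻¹) (fun x hx => by
    rw [← hmap 0 h0] at hx
    obtain ⟨s, hs, rfl⟩ := Submodule.mem_map.mp hx
    have : w 1 * (w 0)⁻¹ * (LinearMap.mulRight F (w 0) s) = LinearMap.mulRight F (w 1) s := by
      simp only [LinearMap.mulRight_apply]
      field_simp
    rw [this, ← hmap 1 h1]
    exact Submodule.mem_map_of_mem hs)
  have hrel : w 1 = c • w 0 := by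
    rw [Algebra.smul_def, ← hc, inv_mul_cancel_right₀ hw0]
  have := Fintype.linearIndependent_iff.mp hw ![c, -1] (by simp [Fin.sum_univ_two, hrel]) 1
  simp at this

/-- **One-multiplier bound** (Roy: "… is `1` if `l₁ = 3`"): `F`-linearly independent elements of
`K` all lying in `F` number at most one. [cite: Roy1995, §3.2 proof of Theorem 3.4] -/
theorem card_le_one_of_mem_bot {ι : Type*} [Fintype ι] {t : ι → K} (ht : LinearIndependent F t)
    (hmem : ∀ i, ∃ c : F, t i = algebraMap F K c) : Fintype.card ι ≤ 1 := by
  have h := card_le_finrank_of_mem ht (F ∙ (1 : K)) (fun i => by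
    obtain ⟨c, hc⟩ := hmem i
    rw [hc, Algebra.algebraMap_eq_smul_one]
    exact Submodule.smul_mem _ _ (Submodule.mem_span_singleton_self _))
  rwa [finrank_span_singleton (one_ne_zero' K)] at h

/-! ### Roy's claim `d₁ + l₁ ≤ 4 r₁` -/

/-- **Roy's claim `d₁ + l₁ ≤ 4 r₁`.** Let `E₁` be a space of coefficient triples all of whose
rows lie in `S = ⟨rows of A₁⟩_F`, where `A₁ ∈ E₁` is non-zero and has minimal row-span dimension
among the non-zero elements of `E₁`. Then `dim_F E₁ + dim_F S ≤ 4 · dim_K ⟨Φ(E₁)⟩_K`.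
[cite: Roy1995, §3.2 proof of Theorem 3.4 ("We claim that d₁ + l₁ ≤ 4r₁")] -/
theorem claim {lam : Fin 3 → K} (hlam : LinearIndependent F lam)
    (hmul : ∀ s : K, (∀ x ∈ span F (Set.range lam), s * x ∈ span F (Set.range lam)) →
      ∃ c : F, s = algebraMap F K c)
    (Φ : (l : ℕ) → (Fin 3 → Fin l → F) →ₗ[F] (Fin l → K))
    (hΦ : ∀ l A j, Φ l A j = ∑ k, A k j • lam k)
    {l : ℕ} (E₁ : Submodule F (Fin 3 → Fin l → F)) {A₁ : Fin 3 → Fin l → F} (hA₁ : A₁ ∈ E₁)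
    (hA₁0 : A₁ ≠ 0) (hrows : ∀ A ∈ E₁, ∀ k, A k ∈ span F (Set.range A₁))
    (hmin : ∀ A ∈ E₁, A ≠ 0 →
      finrank F (span F (Set.range A₁)) ≤ finrank F (span F (Set.range A))) :
    finrank F E₁ + finrank F (span F (Set.range A₁)) ≤
      4 * finrank K (span K (E₁.map (Φ l) : Set (Fin l → K))) := by
  classical
  set S := span F (Set.range A₁) with hS
  set p₁ := span K (E₁.map (Φ l) : Set (Fin l → K)) with hp₁
  -- (KS): a rational form not killing `A₁` is injective on `E₁`.
  have hKS : ∀ φ : Fin l → F, (fun k => A₁ k ⬝ᵥ φ) ≠ 0 →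
      ∀ A ∈ E₁, (fun k => A k ⬝ᵥ φ) = 0 → A = 0 := by
    intro φ hφ A hA hAφ
    by_contra hA0
    have hle : span F (Set.range A) ≤ S := by
      rw [span_le]
      rintro _ ⟨k, rfl⟩
      exact hrows A hA k
    have heq : span F (Set.range A) = S := Submodule.eq_of_le_of_finrank_le hle (hmin A hA hA0)
    apply hφ
    funext k
    have hk : A₁ k ∈ span F (Set.range A) := by
      rw [heq]
      exact subset_span ⟨k, rfl⟩
    have hker : ∀ v ∈ span F (Set.range A), v ⬝ᵥ φ = 0 := by
      intro v hv
      induction hv using Submodule.span_induction with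
      | mem x hx =>
        obtain ⟨k', rfl⟩ := hx
        exact congr_fun hAφ k'
      | zero => exact zero_dotProduct φ
      | add x y _ _ hx hy => rw [add_dotProduct, hx, hy, add_zero]
      | smul c x _ hx => rw [smul_dotProduct, hx, smul_zero]
    exact hker _ hk
  -- `d₁ ≤ 3`
  have hd3 : finrank F E₁ ≤ 3 := by
    obtain ⟨k₀, j₀, hkj⟩ : ∃ k j, A₁ k j ≠ 0 := by
      by_contra h
      push Not at h
      exact hA₁0 (funext fun k => funext fun j => h k j)
    have hφ₀ : (fun k => A₁ k ⬝ᵥ Pi.single j₀ 1) ≠ 0 := by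
      intro h
      apply hkj
      simpa using congr_fun h k₀
    let T : E₁ →ₗ[F] (Fin 3 → F) :=
      { toFun := fun A k => (A : Fin 3 → Fin l → F) k ⬝ᵥ Pi.single j₀ 1
        map_add' := fun A B => by
          funext k
          simp
        map_smul' := fun c A => by
          funext k
          simp }
    have hT : Function.Injective T := by
      intro x y hxy
      rw [← sub_eq_zero, ← map_sub] at hxy
      have h := hKS _ hφ₀ _ (x - y).2 (by
        funext k
        simpa [T] using congr_fun hxy k)
      rw [← sub_eq_zero]
      exact Subtype.ext (by simp [h])
    simpa using LinearMap.finrank_le_finrank_of_injective hT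
  have hl3 : finrank F S ≤ 3 := by
    simpa [Set.finrank] using finrank_range_le_card (R := F) A₁
  -- `r₁ ≥ 1`
  have hmemp : ∀ A ∈ E₁, Φ l A ∈ p₁ := fun A hA => subset_span ⟨A, hA, rfl⟩
  have hv0 : Φ l A₁ ≠ 0 := fun h =>
    hA₁0 (realize_injective hlam Φ hΦ l (by rw [h, map_zero]))
  have hr1 : finrank K p₁ ≠ 0 := by
    rw [Ne, Submodule.finrank_eq_zero]
    intro h
    exact hv0 ((Submodule.eq_bot_iff _).mp h _ (hmemp A₁ hA₁))
  rcases (show finrank K p₁ = 1 ∨ 2 ≤ finrank K p₁ by omega) with h1 | h2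
  swap
  · omega
  -- `r₁ = 1`: every realised row of `E₁` is a `K`-multiple of `Φ A₁`.
  have hmul1 : ∀ A ∈ E₁, ∃ s : K, s • Φ l A₁ = Φ l A := by
    intro A hA
    obtain ⟨s, hs⟩ := (finrank_eq_one_iff_of_nonzero' (⟨Φ l A₁, hmemp A₁ hA₁⟩ : p₁)
      (by simpa using hv0)).mp h1 ⟨Φ l A, hmemp A hA⟩
    exact ⟨s, by simpa using congrArg Subtype.val hs⟩
  let b := Module.finBasis F E₁
  choose t ht using fun i => hmul1 (b i) (b i).2
  -- the multipliers are `F`-linearly independent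
  have htli : LinearIndependent F t := by
    rw [Fintype.linearIndependent_iff]
    intro c hc i
    have hsum : Φ l (∑ i, c i • (b i : Fin 3 → Fin l → F)) = 0 := by
      rw [map_sum]
      have : ∀ i, Φ l (c i • (b i : Fin 3 → Fin l → F)) = (c i • t i) • Φ l A₁ :=
        fun i => by rw [map_smul, ← ht i, smul_assoc]
      simp_rw [this, ← Finset.sum_smul, hc, zero_smul]
    have h0 : (∑ i, c i • (b i : Fin 3 → Fin l → F)) = 0 :=
      realize_injective hlam Φ hΦ l (by rw [hsum, map_zero])
    have h0' : (∑ i, c i • b i) = 0 := by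
      apply Subtype.ext
      simpa [Submodule.coe_sum] using h0
    exact Fintype.linearIndependent_iff.mp b.linearIndependent c h0' i
  -- and they map `L₁ = ⟨entries of Φ A₁⟩_F` into `L₀`
  have hL₁ : ∀ i, ∀ y ∈ span F (Set.range (Φ l A₁)), t i * y ∈ span F (Set.range lam) := by
    intro i y hy
    have hle : span F (Set.range (Φ l A₁)) ≤
        (span F (Set.range lam)).comap (LinearMap.mulLeft F (t i)) := by
      rw [span_le]
      rintro _ ⟨j, rfl⟩
      simp only [SetLike.mem_coe, Submodule.mem_comap, LinearMap.mulLeft_apply]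
      have hj := congr_fun (ht i) j
      simp only [Pi.smul_apply, smul_eq_mul] at hj
      rw [hj]
      exact realize_apply_mem Φ hΦ l _ j
    exact hle hy
  have hd₁ : Fintype.card (Fin (finrank F E₁)) = finrank F E₁ := Fintype.card_fin _
  -- `L₁` is the image of the column span of `A₁` under `β : F³ ≃ L₀`
  set β := Fintype.linearCombination F lam with hβ
  have hβinj : Function.Injective β :=
    linearIndependent_iff_injective_fintypeLinearCombination.mp hlam
  have hcomp : ⇑β ∘ (fun j k => A₁ k j) = Φ l A₁ := by
    funext j
    rw [Function.comp_apply, hβ, Fintype.linearCombination_apply, hΦ]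
  have hL₁eq : span F (Set.range (Φ l A₁)) = (span F (Set.range fun j k => A₁ k j)).map β := by
    rw [Submodule.map_span, ← Set.range_comp, hcomp]
  have hcols : finrank F (span F (Set.range fun j k => A₁ k j)) = finrank F S :=
    finrank_span_cols_eq A₁
  rcases (show finrank F S ≤ 1 ∨ finrank F S = 2 ∨ finrank F S = 3 by omega) with hS1 | hS2 | hS3
  · omega
  · -- `l₁ = 2`: at most two independent multipliers
    have hfin2 : finrank F (span F (Set.range (Φ l A₁))) = 2 := by
      rw [hL₁eq, (Submodule.equivMapOfInjective β hβinj _).finrank_eq.symm, hcols, hS2]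
    haveI : Module.Finite F (span F (Set.range (Φ l A₁))) :=
      Module.Finite.span_of_finite F (Set.finite_range _)
    let bw := Module.finBasisOfFinrankEq F _ hfin2
    let w : Fin 2 → K := fun i => (bw i : K)
    have hw : LinearIndependent F w := by
      have h := bw.linearIndependent.map' (span F (Set.range (Φ l A₁))).subtype
        (Submodule.ker_subtype (span F (Set.range (Φ l A₁))))
      simpa [w, Function.comp_def] using h
    have hwmem : ∀ i, w i ∈ span F (Set.range (Φ l A₁)) := fun i => (bw i).2
    suffices ¬ 3 ≤ finrank F E₁ by omega
    intro h3
    have ht3 : LinearIndependent F (t ∘ Fin.castLE h3) := htli.comp _ (Fin.castLE_injective h3)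
    exact not_three_multipliers hlam hmul hw ht3 (fun i => hL₁ _ _ (hwmem 0))
      (fun i => hL₁ _ _ (hwmem 1))
  · -- `l₁ = 3`: `L₁ = L₀`, so each multiplier stabilises `L₀` and lies in `F`
    have htop : span F (Set.range fun j k => A₁ k j) = ⊤ := by
      apply Submodule.eq_top_of_finrank_eq
      rw [hcols, hS3, Module.finrank_fin_fun]
    have hL₁L₀ : span F (Set.range (Φ l A₁)) = span F (Set.range lam) := by
      rw [hL₁eq, htop, Submodule.map_top, hβ, Fintype.range_linearCombination]
    have hmemF : ∀ i, ∃ c : F, t i = algebraMap F K c := fun i =>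
      hmul (t i) (fun x hx => hL₁ i x (hL₁L₀ ▸ hx))
    have := card_le_one_of_mem_bot htli hmemF
    omega

/-! ### The induction and the theorem -/

/-- **Theorem 3.4 on coefficient triples** (the induction): for every `F`-subspace `E` of
coefficient triples in `F^l` satisfying the column condition,
`dim_F E + l ≤ 4 · dim_K ⟨Φ(E)⟩_K`. Strong induction on `l`, splitting off the minimal rational
envelope of a row (`claim`, `rank_split`, `colCond_map`).
[cite: Roy1995, §3.2 proof of Theorem 3.4] -/
theorem finrank_add_le {lam : Fin 3 → K} (hlam : LinearIndependent F lam)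
    (hmul : ∀ s : K, (∀ x ∈ span F (Set.range lam), s * x ∈ span F (Set.range lam)) →
      ∃ c : F, s = algebraMap F K c)
    (Φ : (l : ℕ) → (Fin 3 → Fin l → F) →ₗ[F] (Fin l → K))
    (hΦ : ∀ l A j, Φ l A j = ∑ k, A k j • lam k) (l : ℕ) :
    ∀ E : Submodule F (Fin 3 → Fin l → F),
      (∀ c : Fin l → F, (∀ A ∈ E, ∀ k, A k ⬝ᵥ c = 0) → c = 0) →
      finrank F E + l ≤ 4 * finrank K (span K (E.map (Φ l) : Set (Fin l → K))) := by
  induction l using Nat.strong_induction_on with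
  | _ l ih =>
  intro E hcol
  classical
  by_cases hE : E = ⊥
  · subst hE
    have hl : l = 0 := by
      by_contra hl
      have h := hcol (Pi.single (⟨0, Nat.pos_of_ne_zero hl⟩ : Fin l) (1 : F)) (fun A hA k => by
        rw [(Submodule.mem_bot F).mp hA]
        simp)
      have h0 := congr_fun h (⟨0, Nat.pos_of_ne_zero hl⟩ : Fin l)
      simp at h0
    subst hl
    simp
  -- a non-zero element of minimal row-span dimension
  have hex : ∃ n, ∃ A ∈ E, A ≠ 0 ∧ finrank F (span F (Set.range A)) = n := by
    obtain ⟨A, hA, hA0⟩ := (Submodule.ne_bot_iff E).mp hE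
    exact ⟨_, A, hA, hA0, rfl⟩
  obtain ⟨A₁, hA₁E, hA₁0, hA₁n⟩ := Nat.find_spec hex
  have hmin : ∀ A ∈ E, A ≠ 0 →
      finrank F (span F (Set.range A₁)) ≤ finrank F (span F (Set.range A)) := by
    intro A hA hA0
    rw [hA₁n]
    exact Nat.find_min' hex ⟨A, hA, hA0, rfl⟩
  set S := span F (Set.range A₁) with hS
  -- `1 ≤ l₁ ≤ l`
  have hl₁pos : finrank F S ≠ 0 := by
    rw [Ne, Submodule.finrank_eq_zero]
    intro h
    apply hA₁0
    funext k
    exact (Submodule.eq_bot_iff _).mp h _ (subset_span ⟨k, rfl⟩)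
  have hl₁l : finrank F S ≤ l := S.finrank_le.trans (Module.finrank_fin_fun F).le
  -- the quotient map by `S` and the induction hypothesis for the image ("`M₂`")
  obtain ⟨g, hg, hker⟩ := exists_surjective_ker_eq S
  have ih₂ := ih (l - finrank F S) (by omega) (E.map (g.compLeft (Fin 3))) (colCond_map hg hcol)
  -- the kernel part `E₁ = E ∩ ker g` ("`M₁`")
  have hA₁E₁ : A₁ ∈ E ⊓ LinearMap.ker (g.compLeft (Fin 3)) := by
    refine Submodule.mem_inf.mpr ⟨hA₁E, ?_⟩
    rw [LinearMap.mem_ker]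
    funext k
    rw [LinearMap.compLeft_apply, Function.comp_apply, Pi.zero_apply, ← LinearMap.mem_ker, hker]
    exact subset_span ⟨k, rfl⟩
  have hrows : ∀ A ∈ E ⊓ LinearMap.ker (g.compLeft (Fin 3)), ∀ k, A k ∈ S := by
    intro A hA k
    rw [← hker, LinearMap.mem_ker]
    have h := congr_fun (LinearMap.mem_ker.mp hA.2) k
    simpa using h
  have hclaim := claim hlam hmul Φ hΦ (E ⊓ LinearMap.ker (g.compLeft (Fin 3))) hA₁E₁ hA₁0 hrows
    (fun A hA hA0 => hmin A hA.1 hA0)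
  rw [← hS] at hclaim
  have hd := finrank_eq_finrank_map_add (g.compLeft (Fin 3)) E
  have hr := rank_split Φ hΦ g E
  omega

/-- **Roy 1995, Theorem 3.4, over an arbitrary field extension `K/F`** in place of `ℂ/ℚ`, with the
arithmetic input isolated as the multiplier property of `L₀ = ⟨λ₁, λ₂, λ₃⟩_F` (`s L₀ ⊆ L₀ ⇒ s ∈ F`,
which holds when the `λ`'s are linearly independent over the algebraic closure of `F` in `K`,
`exists_eq_algebraMap_of_mul_mem_span`): a `d × l` matrix with entries in `L₀`, `F`-independent
rows and `F`-independent columns has `d + l ≤ 4 · rank`. [cite: Roy1995, Theorem 3.4 p. 66] -/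
theorem add_le_four_mul_rank {lam : Fin 3 → K} (hlam : LinearIndependent F lam)
    (hmul : ∀ s : K, (∀ x ∈ span F (Set.range lam), s * x ∈ span F (Set.range lam)) →
      ∃ c : F, s = algebraMap F K c)
    {d l : ℕ} (M : Matrix (Fin d) (Fin l) K) (hM : ∀ i j, M i j ∈ span F (Set.range lam))
    (hrows : LinearIndependent F (fun i => M i))
    (hcols : LinearIndependent F (fun j => M.transpose j)) : d + l ≤ 4 * M.rank := by
  classical
  -- the realisation maps `Φ l A = (Σ_k A k j • λ_k)_j`
  let Φ : (l : ℕ) → (Fin 3 → Fin l → F) →ₗ[F] (Fin l → K) := fun l =>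
    { toFun := fun A j => ∑ k, A k j • lam k
      map_add' := fun A B => by
        funext j
        simp only [Pi.add_apply, add_smul, Finset.sum_add_distrib]
      map_smul' := fun c A => by
        funext j
        simp only [Pi.smul_apply, smul_eq_mul, RingHom.id_apply, Finset.smul_sum, mul_smul] }
  have hΦ : ∀ l (A : Fin 3 → Fin l → F) j, Φ l A j = ∑ k, A k j • lam k := fun _ _ _ => rfl
  -- coefficient triples of the rows of `M`
  have hcoef : ∀ i j, ∃ c : Fin 3 → F, ∑ k, c k • lam k = M i j := fun i j =>
    (Submodule.mem_span_range_iff_exists_fun F).mp (hM i j)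
  choose coef hcoef using hcoef
  let A : Fin d → (Fin 3 → Fin l → F) := fun i k j => coef i j k
  have hreal : ∀ i, Φ l (A i) = M i := fun i => funext fun j => hcoef i j
  have hcomp : ⇑(Φ l) ∘ A = fun i => M i := funext hreal
  let E : Submodule F (Fin 3 → Fin l → F) := span F (Set.range A)
  -- `dim_F E = d`
  have hAli : LinearIndependent F A :=
    LinearIndependent.of_comp (Φ l) (by rw [hcomp]; exact hrows)
  have hdE : finrank F E = d := by
    rw [finrank_span_eq_card hAli, Fintype.card_fin]
  -- the column condition
  have hcolE : ∀ c : Fin l → F, (∀ B ∈ E, ∀ k, B k ⬝ᵥ c = 0) → c = 0 := by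
    intro c hc
    refine funext (Fintype.linearIndependent_iff.mp hcols c ?_)
    funext i
    have hi := hc (A i) (subset_span ⟨i, rfl⟩)
    have : (∑ j, c j • M.transpose j) i = ∑ k, (A i k ⬝ᵥ c) • lam k := by
      simp only [Finset.sum_apply, Pi.smul_apply, Matrix.transpose_apply, ← hreal i,
        hΦ, Finset.smul_sum, dotProduct, Finset.sum_smul, smul_smul, mul_comm (c _)]
      exact Finset.sum_comm
    rw [this]
    simp [hi]
  -- the `K`-span of the realised rows is the row space of `M`
  have hspan : span K (E.map (Φ l) : Set (Fin l → K)) = span K (Set.range M.row) := by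
    rw [Submodule.map_span, ← Set.range_comp, hcomp]
    exact Submodule.span_span_of_tower F K (Set.range M.row)
  have h := finrank_add_le hlam hmul Φ hΦ l E hcolE
  rwa [hdE, hspan, ← Matrix.rank_eq_finrank_span_row] at h

end Roy1995

/-- **Roy 1995, Theorem 3.4 — discharged.** The named fact `roy1995_thm_3_4` holds: a `d × l`
matrix with entries in `⟨λ₁, λ₂, λ₃⟩_ℚ` (`λ`'s linearly independent over `ℚ̄`), with
`ℚ`-independent rows and `ℚ`-independent columns, has `4 · rank ≥ d + l`. Roy's proof
(§3.2): induction splitting off the minimal `ℚ`-defined subspace containing a row; the only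
arithmetic input is the multiplier lemma `exists_eq_algebraMap_of_mul_mem_span`.
[cite: Roy1995, Theorem 3.4 p. 66] -/
theorem roy1995_thm_3_4_holds : roy1995_thm_3_4 := by
  intro d l _hd _hl lam hlam M hM hrows hcols
  have hlamQ : LinearIndependent ℚ lam := hlam.restrict_scalars (by
    intro r s h
    exact (algebraMap ℚ (algebraicClosure ℚ ℂ)).injective
      (by simpa only [Algebra.algebraMap_eq_smul_one] using h))
  exact Roy1995.add_le_four_mul_rank hlamQ
    (fun s hs => exists_eq_algebraMap_of_mul_mem_span (F := ℚ) (n := 2) hlam hs) M hM hrows hcols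

/-- **The catalogue declaration `LinearSubgroupMethodLimit` (= `roy1995_thm_3_4`) holds** — the
discharge under the canonical `<FactName>_holds` name of the named-fact registry (users holding
`(h : LinearSubgroupMethodLimit)` are fed this theorem). It is `roy1995_thm_3_4_holds` seen through
`linearSubgroupMethodLimit_iff`. [cite: Roy1995, Theorem 3.4 p. 66 and §3.2 p. 65] -/
theorem LinearSubgroupMethodLimit_holds : LinearSubgroupMethodLimit :=
  roy1995_thm_3_4_holds

/-- Lower-camel synonym of `LinearSubgroupMethodLimit_holds` (the name under which this discharge
first landed; kept so that existing references stay valid); prefer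
`LinearSubgroupMethodLimit_holds`.
[cite: Roy1995, Theorem 3.4 p. 66 and §3.2 p. 65] -/
theorem linearSubgroupMethodLimit_holds : LinearSubgroupMethodLimit :=
  LinearSubgroupMethodLimit_holds

/-- **The no-go, unconditionally**: no `d × l` matrix (`d, l ≥ 1`) built `ℚ`-linearly from three
`ℚ̄`-linearly independent complex numbers, with `ℚ`-independent rows and columns, satisfies the
rank hypothesis `r(d+l) < dl` of the linear subgroup theorem (Roy 1995, Thm 1.2).
[cite: Roy1995, §3.2 p. 65 and Theorem 3.4 p. 66] -/
theorem not_lstHypothesis {d l : ℕ} (hd : 0 < d) (hl : 0 < l) {lam : Fin 3 → ℂ}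
    (hlam : LinearIndependent (algebraicClosure ℚ ℂ) lam) (M : Matrix (Fin d) (Fin l) ℂ)
    (hM : ∀ i j, M i j ∈ Submodule.span ℚ (Set.range lam))
    (hrows : LinearIndependent ℚ (fun i => M i))
    (hcols : LinearIndependent ℚ (fun j => M.transpose j)) :
    ¬ LSTHypothesis d l M.rank :=
  not_lstHypothesis_of_roy1995_thm_3_4 roy1995_thm_3_4_holds hd hl hlam M hM hrows hcols

end Literature.Barriers.Schanuel
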